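import Summits.PneNP.PneNP.Theorems.SignDeg1AvoidFP
import Summits.PneNP.PneNP.Theorems.SignDeg2Signing

/-!
# F-N2a rung BY NAME: `SignDeg2Signing.SignDeg1AvoidLinearFP k` for every `k`

Cell pnp-ideate, ROUND-17 rung F-N2a (`--supports stmt-PneNP-19007`).  pnp-ideate-p3's rung statement
`SignDeg2Signing.SignDeg1AvoidLinearFP k := LocalAvoidLinearFP k (fun _ _ I => ∀ j, SignDegLE 1 (I.table j))`
(range avoidance for `LTF`-local maps — all output tables of sign-degree ≤ 1 — at linear stretch is in FP)
was filed as an `@[conjecture]` def while its proof `SignDeg1AvoidFP.signDeg1_localAvoidLinearFP` (stated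
literally against `LocalAvoidLinearFP`, since the two files landed concurrently) went through the gate.  This
file records the closure by name.  Restricted-model algorithmic rung of the range-avoidance ladder; no
bearing on `P` versus `NP`.
-/

set_option linter.dupNamespace false -- `Summit.PneNP.PneNP.…`: summit = sub-problem name (D-0017 single-conjunct layout)

namespace Summit.PneNP.PneNP.Theorems.SignDeg1AvoidFP

/-- **F-N2a rung, by name**: `SignDeg2Signing.SignDeg1AvoidLinearFP k` holds for every locality `k` (it unfolds
to `signDeg1_localAvoidLinearFP k`: the weighted one-pass greedy signing `sd1Str k`, polynomial time, avoids
the range of every `k`-local map with sign-degree-≤1 tables once `m ≥ (2·(uniformW k 1)² + 1)·n`). -/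
theorem signDeg1AvoidLinearFP_holds (k : ℕ) : SignDeg2Signing.SignDeg1AvoidLinearFP k :=
  signDeg1_localAvoidLinearFP k

end Summit.PneNP.PneNP.Theorems.SignDeg1AvoidFP
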